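import Summits.BirchSwinnertonDyer.BirchSwinnertonDyer.Theorems.ByReductionTypeAtTwoTowerFiltrationExponentTame
import HarnessLib

/-!
# The MODULE-FILTRATION certificate, part 7: the `p = 2` gap from the TAME exponent lever (route ByReductionTypeAtTwo,
# crux `MultUpperHalfAtTwo`, item stmt-BirchSwinnertonDyer-19922; seat bsd-2adic-mult-2 GEN 11, part 4 of the kernel)

HONEST FRAMING (cell `bsd-2adic`, run/shared/lean/pub/bsd-2adic/, HUMAN RULINGS D-0036/D-0054/D-0074): THEOREMS
ONLY; nothing asserted; no definition; no new named fact; closes nothing by itself; BSD is not proved by any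
of this. PARTITION: X5@2 mult (K4ᵐ, B1·O1) × p = 2 — types-the-object-of; closes none. bears_on: K4 (item 19922).

`towerGapAtTwo_of_exponent_localKernelBounds_tame` = part 5's `towerGapAtTwo_of_exponent_localKernelBounds` on part 6's
`iterate_conjSubId_mem_selmerLayer_of_localKernelBounds_tame`: per place EITHER the count `C_v^{N_v} ≤ 2^t` OR the tame data
(`g ≤ t`, `g = 2^a`, `γ^g ∈ res(Γ_{ℚ_v})·Gal(ℚ̄/ℚ_n)` — automatic at the totally ramified place over `2` with `g = 1`
(`TowerLayer.cover_singleton_at_p`) —, and the decomposition group acting trivially by conjugation on `𝒦_{v,n}[2^∞][2]`).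
The local triviality statements are hypotheses here (WANTED from the tower-1 lane for the non-split `2` with Tate unit `≡ ±1 (8)`).

References: R. Greenberg, LNM 1716 (1999), §1 p. 60, §3 pp. 85–90; L. Washington, *Introduction to Cyclotomic Fields*, §13.
-/
set_option autoImplicit false
-- the Theorems namespace of this sub repeats the summit name by design (D-0017 nested layout: Summit.<S>.<Sub>)
set_option linter.dupNamespace false

noncomputable section

open scoped Classical

open NumberField IsDedekindDomain WeierstrassCurve Literature.NumberTheory.EllipticCurves
  Literature.NumberTheory.EllipticCurves.IwasawaDual PowerSeries Summit.BirchSwinnertonDyer.Rank1Residual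
  Summit.BirchSwinnertonDyer.Rank1Residual.X5.TowerGap Summit.BirchSwinnertonDyer.Rank1Residual.X5.O1

universe u

namespace Summit.BirchSwinnertonDyer.BirchSwinnertonDyer.Theorems.TowerFiltration

section Curve

variable (W : WeierstrassCurve ℚ) [W.IsElliptic]

/-- **The EXPONENT gap certificate with EXPLICIT local error terms — TAME variant.** As part 5's
`towerGapAtTwo_of_exponent_localKernelBounds`, each place charged by the count `C_v^{N_v} ≤ 2^t` OR by the tame data of part 6
(`g ≤ t`, `g = 2^a`, `γ^g ∈ res(Γ_{ℚ_v})·Gal(ℚ̄/ℚ_n)`, trivial conjugation action on `𝒦_{v,n}[2^∞][2]`). ORIGINAL DOCSTRING: `W/ℚ` with odd torsion order; a layer `n`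
and `e + t < 2ⁿ`; the EXPONENT certificate `(conj_γ − id)^[e] z = 0` for every `2`-torsion class `z` of
`Sel_{2^∞}(E/ℚ_n)` and every cyclotomic `κ` with topological generator `γ` (ENGINE A: `s(e) = s(2ⁿ)` in the
`S2| SIGMA` vector); a finite set `S` of places with, at level `n`: `𝒦_{v,n}[2^∞] = 0` off `S` (`h0`),
`#𝒦_{v,n}[2] ≤ C_v` on `S` (`hC`), covering sets of size `≤ N_v` (`hN`); and **every local block small:
`C_v^{N_v} ≤ 2^t` for `v ∈ S`**. Then `O1.TowerGapAtTwo W` with `(m, k) = (e + t, 1)`: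
`ν^{t}(A_n[2]) ⊆ Sel_n[2]` (§6) and `ν^{e}(Sel_n[2]) = 0` give `ν^{e+t}(A_n[2]) = 0`, so
`#X/(2,T^{e+t+1})X = #A_n[2] = #X/(2,T^{e+t})X < 2 · #X/(2,T^{e+t})X` (§2's one-layer count).
[cite: GreenbergLNM1716, §1 p. 60 and §3 pp. 85–90 (Lemmas 3.3–3.5)] [cite: Washington1997, §13.2] -/
theorem towerGapAtTwo_of_exponent_localKernelBounds_tame (htors : ¬ 2 ∣ W.torsionOrder) {n e t : ℕ}
    (het : e + t < 2 ^ n) (S : Finset (HeightOneSpectrum (𝓞 ℚ))) (C N : HeightOneSpectrum (𝓞 ℚ) → ℕ)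
    (hstat : ∀ (κ : ZpExtension ℚ 2) (γ : Field.absoluteGaloisGroup ℚ), κ.IsCyclotomic →
      κ.IsTopGenerator γ → ∀ z : W.selmerLayer κ n, 2 • z = 0 →
        (⇑(W.conjH1 2 (κ.layerSubgroup n) γ -
          AddMonoidHom.id (W.subgroupH1 2 (κ.layerSubgroup n))))^[e]
          (z : W.subgroupH1 2 (κ.layerSubgroup n)) = 0)
    (h0 : ∀ κ : ZpExtension ℚ 2, κ.IsCyclotomic →
      ∀ v ∉ S, W.localTowerKerPrimary κ (v.adicCompletion ℚ) n = ⊥)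
    (hC : ∀ κ : ZpExtension ℚ 2, κ.IsCyclotomic → ∀ v ∈ S,
      Finite {x : W.localTowerKerPrimary κ (v.adicCompletion ℚ) n // 2 • x = 0} ∧
        Nat.card {x : W.localTowerKerPrimary κ (v.adicCompletion ℚ) n // 2 • x = 0} ≤ C v)
    (hN : ∀ κ : ZpExtension ℚ 2, κ.IsCyclotomic → ∀ v ∈ S,
      ∃ R : Finset (Field.absoluteGaloisGroup ℚ), R.card ≤ N v ∧
        ∀ σ : Field.absoluteGaloisGroup ℚ, ∃ ρ ∈ R,
          ∃ δ : Field.absoluteGaloisGroup (v.adicCompletion ℚ), ∃ τ ∈ κ.layerSubgroup n,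
            σ = resGal (K := ℚ) (v.adicCompletion ℚ) δ * ρ * τ)
    (hexp : ∀ (κ : ZpExtension ℚ 2) (γ : Field.absoluteGaloisGroup ℚ), κ.IsCyclotomic → κ.IsTopGenerator γ →
      ∀ v ∈ S, C v ^ N v ≤ 2 ^ t ∨
        ∃ g : ℕ, g ≤ t ∧ (∃ a : ℕ, g = 2 ^ a) ∧
          (∃ δ : Field.absoluteGaloisGroup (v.adicCompletion ℚ), ∃ τ ∈ κ.layerSubgroup n,
            γ ^ g = resGal (K := ℚ) (v.adicCompletion ℚ) δ * τ) ∧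
          ∀ (δ : Field.absoluteGaloisGroup (v.adicCompletion ℚ))
            (x : discreteH1 (localSubgroup (κ.layerSubgroup n) (v.adicCompletion ℚ)) (localPoints W (v.adicCompletion ℚ))),
            x ∈ W.localTowerKerPrimary κ (v.adicCompletion ℚ) n → 2 • x = 0 →
              Literature.NumberTheory.EllipticCurves.conjH1 (localSubgroup (κ.layerSubgroup n) (v.adicCompletion ℚ))
                (localPoints W (v.adicCompletion ℚ)) δ x = x) :
    TowerGapAtTwo W := by
  intro κ γ hκ hγ _ D
  haveI : Module.Finite (IwasawaAlgebra 2) D.X := D.module_finite_holds hγ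
  have hK := Iwasawa.forall_smul_eq_zero_imp_of_not_dvd_torsionOrder W htors
  choose! R hRcard hRcov using hN κ hκ
  -- `1 ≤ C v` on `S`, hence `C_v^{#R_v} ≤ C_v^{N_v} ≤ 2^t`
  have hCpos : ∀ v ∈ S, 1 ≤ C v := fun v hv ↦ by
    haveI := (hC κ hκ v hv).1
    haveI : Nonempty {x : W.localTowerKerPrimary κ (v.adicCompletion ℚ) n // 2 • x = 0} :=
      ⟨⟨0, smul_zero _⟩⟩
    exact Nat.succ_le_of_lt (lt_of_lt_of_le Nat.card_pos (hC κ hκ v hv).2)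
  have hexp' : ∀ v ∈ S, C v ^ (R v).card ≤ 2 ^ t ∨
      ∃ g : ℕ, g ≤ t ∧ (∃ a : ℕ, g = 2 ^ a) ∧
        (∃ δ : Field.absoluteGaloisGroup (v.adicCompletion ℚ), ∃ τ ∈ κ.layerSubgroup n,
          γ ^ g = resGal (K := ℚ) (v.adicCompletion ℚ) δ * τ) ∧
        ∀ (δ : Field.absoluteGaloisGroup (v.adicCompletion ℚ))
          (x : discreteH1 (localSubgroup (κ.layerSubgroup n) (v.adicCompletion ℚ)) (localPoints W (v.adicCompletion ℚ))),
          x ∈ W.localTowerKerPrimary κ (v.adicCompletion ℚ) n → 2 • x = 0 →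
            Literature.NumberTheory.EllipticCurves.conjH1 (localSubgroup (κ.layerSubgroup n) (v.adicCompletion ℚ))
              (localPoints W (v.adicCompletion ℚ)) δ x = x := fun v hv ↦
    (hexp κ γ hκ hγ v hv).imp_left fun h ↦ (Nat.pow_le_pow_right (hCpos v hv) (hRcard v hv)).trans h
  haveI hfin := TowerLayer.finite_layerClasses W κ D hK n
  set ν : W.subgroupH1 2 (κ.layerSubgroup n) →+ W.subgroupH1 2 (κ.layerSubgroup n) :=
    W.conjH1 2 (κ.layerSubgroup n) γ - AddMonoidHom.id (W.subgroupH1 2 (κ.layerSubgroup n)) with hν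
  -- `ν^[m]` kills `A_n[2]` for `m ≥ e + t`
  have hkill : ∀ m, e + t ≤ m → ∀ y ∈ W.selmerInftyPreimage κ n, 2 • y = 0 → (⇑ν)^[m] y = 0 := by
    intro m hm y hy hpy
    obtain ⟨hsel, hp2⟩ := iterate_conjSubId_mem_selmerLayer_of_localKernelBounds_tame W κ (γ := γ) S C R
      (h0 κ hκ) (hC κ hκ) hRcov hexp' hfin hy hpy
    have h1 : (⇑ν)^[e] ((⇑ν)^[t] y) = 0 :=
      hstat κ γ hκ hγ ⟨_, hsel⟩ (TowerLayer.nsmul_mk_eq_zero _ _ hp2)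
    rw [show m = (m - (e + t)) + (e + t) by omega, Function.iterate_add_apply, Function.iterate_add_apply, h1,
      iterate_map_zero]
  have hcount : ∀ m, e + t ≤ m →
      Nat.card {z : W.selmerInftyPreimage κ n // 2 • z = 0 ∧ (⇑ν)^[m] (z : W.subgroupH1 2 (κ.layerSubgroup n)) = 0} =
        Nat.card {z : W.selmerInftyPreimage κ n // 2 • z = 0} := fun m hm ↦
    Nat.card_congr (Equiv.subtypeEquivRight fun z ↦ ⟨fun h ↦ h.1, fun h ↦ ⟨h, hkill m hm z.1 z.2 (by
      have := congrArg (fun w : W.selmerInftyPreimage κ n ↦ (w : W.subgroupH1 2 (κ.layerSubgroup n))) h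
      simpa using this)⟩⟩)
  haveI : Nonempty {z : W.selmerInftyPreimage κ n // 2 • z = 0} := ⟨⟨0, smul_zero _⟩⟩
  have hpos : 0 < Nat.card {z : W.selmerInftyPreimage κ n // 2 • z = 0} := Nat.card_pos
  refine ⟨e + t, 1, ?_⟩
  rw [natCard_quotient_towerIdeal_eq_natCard_layerFiltration W κ D hγ hK n (m := e + t + 1) (by omega),
    natCard_quotient_towerIdeal_eq_natCard_layerFiltration W κ D hγ hK n (m := e + t) (by omega),
    hcount (e + t + 1) (by omega), hcount (e + t) le_rfl, pow_one]
  omega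


end Curve

end Summit.BirchSwinnertonDyer.BirchSwinnertonDyer.Theorems.TowerFiltration

end
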